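import Summits.ABC.ABC.Theses.TamagawaTwistDictionary
import Summits.ABC.ABC.Theorems.TamagawaTwistDictionaryTamagawaTwistPayoffJPole
import Summits.ABC.ABC.Theorems.PlacewiseSzpiroSingleTowerSzpiroStubPotentiallyGoodTowerOdd
import Summits.ABC.ABC.Theorems.PlacewiseSzpiroSingleTowerSzpiroStubPotentiallyGoodOrdTwo
import Summits.ABC.Harvest.OpenQuestions
import Literature.NumberTheory.DiophantineGeometry.ConductorRadicalProofs
import Literature.NumberTheory.DiophantineGeometry.MinimalDiscriminantFactorizationProofs
import Literature.NumberTheory.DiophantineGeometry.MinimalDiscriminantProofs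
import Mathlib.Analysis.SpecialFunctions.Pow.Real
import HarnessLib

/-!
# Route `TamagawaTwistDictionary` — crux `TamagawaTwistPayoff` (stmt-ABC-24114)

**Pasten's Conjecture 1.14 implies sub-exponential Szpiro** — the twist dictionary:

  `SmallTamagawaConjecture (Tam(E) < K_ε N_E^ε for all E/ℚ) → SubexponentialSzpiro
   (log |Δ_min(E)| ≤ C_ε N_E^ε for all E/ℚ)`.

This is the implication Pasten states without proof (J. Number Theory 254 (2024) =
arXiv:1705.09251, after Thm 1.15: «Conjecture 1.14 is not a mild conjecture; it implies … a
sub-exponential version of Szpiro's conjecture of the form `log Δ_E ≪_ε N_E^ε`, which is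
currently an open problem»). Proof (place by place, no CRT):

* at a place with `ord_v(j_E) ≥ 0` the tower `ord_v(Δ_min) log p` is `≤ 5 log N_E + C` (odd `p`)
  and `ord_2(Δ_min) ≤ B` — Tate's algorithm, the LANDED stubs `stub_potentiallyGoodTowerOdd`
  (p577820) / `stub_potentiallyGoodOrdTwo` (p578899) of the PlacewiseSzpiro line;
* at a place with `ord_v(j_E) = −ν < 0`: `ord_v(Δ_min) ≤ ν + 18` and, under Conj. 1.14,
  `ν ≤ K N_E^{17ε}` (sibling `…JPole`: a small twist `E'` of `E` is SPLIT multiplicative at `v`,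
  so `ν = c_v(E') ≤ Tam(E') < K₀ N_{E'}^ε`, `N_{E'} ≤ 8^8 N_E^{17}`);
* sum over the `ω(N_E) ≤ log N_E / log 2` bad primes (`supp Δ_min = supp N_E`) and absorb the
  powers of `log N_E` into `N_E^ε` (`log x ≤ x^δ/δ`).

Main declarations: `TamagawaTwistPayoffLine.log_minimalDiscriminantNorm_le_mul_of_towers`,
`TamagawaTwistPayoffLine.tower_le_of_smallTamagawa`,
`TamagawaTwistPayoffLine.subexponentialSzpiro_of_smallTamagawa`, and the closer
`tamagawaTwistPayoff_proof : Summit.ABC.ABC.Theses.TamagawaTwistDictionary.TamagawaTwistPayoff`.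

HONESTY. A CONDITIONAL dictionary: X1 = Conj. 1.14 (`SmallTamagawa`, stmt-ABC-24113) is OPEN and
carries no prover; this file proves X1 ⟹ A1′ only. The rung A1′ (`SubexponentialSzpiro`) is NOT
abc and NOT A-PS, and is not proved here; no rung of LADDER-ABC moves. No `sorry`, no new axiom,
no `def`; axioms standard.

References: H. Pasten, *Shimura curves and the abc conjecture*, J. Number Theory 254 (2024),
Conj. 1.14, Thm 1.15 and the remark following it; J. H. Silverman, *AEC* (2009) VII.5, VIII.11;
*ATAEC* (1994) IV.9–IV.11.
-/

noncomputable section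

-- `Summit.<Summit>.<Problem>` is the mandated summit-side namespace (CONVENTIONS §2); for the
-- single-conjunct summit `ABC` the two coincide, so the duplicate `ABC.ABC` is deliberate.
set_option linter.dupNamespace false

namespace Summit.ABC.ABC.Theorems

namespace TamagawaTwistPayoffLine

open scoped NumberField
open IsDedekindDomain WeierstrassCurve Rat.HeightOneSpectrum Literature.NumberTheory.EllipticCurves
open Summit.ABC.ABC.Theorems.SingleTowerSzpiroLine Finset

/-! ### Summing the towers -/

/-- **Summing the towers over the bad primes.** If every finite tower of `E/ℚ` satisfies
`ord_v(Δ_min) · log p_v ≤ B` with `B ≥ 0`, then `log |Δ_min(E)| ≤ (log N_E / log 2) · B`: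
`log |Δ_min| = Σ_{p ∣ Δ_min} ord_p(Δ_min) log p` (unique factorisation, `|Δ_min| = ∏ p^{ord_p}`,
Silverman AEC VIII.8), the primes of `Δ_min` are those of `N_E` (AEC VIII.11), and
`ω(N) log 2 ≤ log N`. [cite: SilvermanAEC2009, VIII.11 (supp Δ_min = supp N_E)] -/
theorem log_minimalDiscriminantNorm_le_mul_of_towers (W : WeierstrassCurve ℚ) [W.IsElliptic] {B : ℝ}
    (hB : 0 ≤ B)
    (h : ∀ v : HeightOneSpectrum ℤ, (W.ordMinimalDiscriminant v : ℝ) * Real.log (natGenerator v : ℝ) ≤ B) :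
    Real.log (W.minimalDiscriminantNorm ℤ : ℝ) ≤ Real.log (W.conductorNorm ℤ : ℝ) / Real.log 2 * B := by
  have hΔ0 : W.minimalDiscriminantNorm ℤ ≠ 0 := (WeierstrassCurve.minimalDiscriminantNorm_pos_holds W).ne'
  have hN0 : W.conductorNorm ℤ ≠ 0 := (WeierstrassCurve.conductorNorm_pos_holds W).ne'
  have hlog2 : (0 : ℝ) < Real.log 2 := Real.log_pos one_lt_two
  have hpf : (W.conductorNorm ℤ).primeFactors = (W.minimalDiscriminantNorm ℤ).primeFactors := by
    rw [← Nat.primeFactors_radical (W.conductorNorm ℤ), WeierstrassCurve.radical_conductorNorm_eq_holds W,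
      Nat.primeFactors_radical]
  -- `log |Δ_min| = Σ_p ord_p log p ≤ #primes · B`
  have hsum : Real.log (W.minimalDiscriminantNorm ℤ : ℝ) ≤
      ((W.minimalDiscriminantNorm ℤ).primeFactors.card : ℝ) * B := by
    have hlog : Real.log (W.minimalDiscriminantNorm ℤ : ℝ) =
        ∑ p ∈ (W.minimalDiscriminantNorm ℤ).primeFactors,
          ((W.minimalDiscriminantNorm ℤ).factorization p : ℝ) * Real.log (p : ℝ) := by
      conv_lhs => rw [Nat.prod_primeFactors_pow_factorization hΔ0]
      push_cast
      rw [Real.log_prod]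
      · exact Finset.sum_congr rfl fun p _ => by rw [Real.log_pow]
      · intro p hp
        exact pow_ne_zero _ (by exact_mod_cast (Nat.prime_of_mem_primeFactors hp).ne_zero)
    rw [hlog]
    calc ∑ p ∈ (W.minimalDiscriminantNorm ℤ).primeFactors,
          ((W.minimalDiscriminantNorm ℤ).factorization p : ℝ) * Real.log (p : ℝ)
        ≤ ∑ p ∈ (W.minimalDiscriminantNorm ℤ).primeFactors, B := by
          refine Finset.sum_le_sum fun p hp => ?_
          have hpp : p.Prime := Nat.prime_of_mem_primeFactors hp
          have hgen : natGenerator ((primesEquiv (R := ℤ)).symm ⟨p, hpp⟩) = p :=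
            congrArg Subtype.val ((primesEquiv (R := ℤ)).apply_symm_apply ⟨p, hpp⟩)
          have hfac : (W.minimalDiscriminantNorm ℤ).factorization p =
              W.ordMinimalDiscriminant ((primesEquiv (R := ℤ)).symm ⟨p, hpp⟩) := by
            conv_lhs => rw [← hgen]
            exact WeierstrassCurve.factorization_minimalDiscriminantNorm_holds W _
          have hv := h ((primesEquiv (R := ℤ)).symm ⟨p, hpp⟩)
          rw [hgen] at hv
          rw [hfac]
          exact hv
      _ = ((W.minimalDiscriminantNorm ℤ).primeFactors.card : ℝ) * B := by
          rw [Finset.sum_const, nsmul_eq_mul]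
  -- `#primes · log 2 ≤ log N`
  have hcard : ((W.conductorNorm ℤ).primeFactors.card : ℝ) * Real.log 2 ≤
      Real.log (W.conductorNorm ℤ : ℝ) := by
    have h2 : 2 ^ (W.conductorNorm ℤ).primeFactors.card ≤ W.conductorNorm ℤ :=
      calc 2 ^ (W.conductorNorm ℤ).primeFactors.card ≤ ∏ p ∈ (W.conductorNorm ℤ).primeFactors, p :=
            Finset.pow_card_le_prod _ _ 2 fun p hp => (Nat.prime_of_mem_primeFactors hp).two_le
        _ = UniqueFactorizationMonoid.radical (W.conductorNorm ℤ) := Nat.radical_eq_prod_primeFactors.symm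
        _ ≤ W.conductorNorm ℤ := Nat.radical_le_self_iff.mpr hN0
    rw [← Real.log_pow]
    exact Real.log_le_log (by positivity) (by exact_mod_cast h2)
  rw [hpf] at hcard
  calc Real.log (W.minimalDiscriminantNorm ℤ : ℝ)
      ≤ ((W.minimalDiscriminantNorm ℤ).primeFactors.card : ℝ) * B := hsum
    _ ≤ Real.log (W.conductorNorm ℤ : ℝ) / Real.log 2 * B := by
        apply mul_le_mul_of_nonneg_right _ hB
        rw [le_div_iff₀ hlog2]
        exact hcard

/-! ### The per-place bound under Conjecture 1.14 -/

/-- **Every finite tower is `≪ N^{17ε} log N` under Conj. 1.14.** Under `SmallTamagawaConjecture`,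
for every `ε > 0` there are `K, C ≥ 0` such that for every elliptic `E/ℚ` and every place `v` of
`ℤ`: `ord_v(Δ_min) · log p_v ≤ (K N_E^{17ε} + 23) · log N_E + C`. Places with `ord_v(j) ≥ 0`:
Tate's algorithm (`stub_potentiallyGoodTowerOdd`, `stub_potentiallyGoodOrdTwo`); places with
`ord_v(j) = −ν < 0`: `ord_v(Δ_min) ≤ ν + 18` and `ν ≤ K N^{17ε}` (`ordMinimalDiscriminant_le_jPole_add`,
`jPole_le_of_smallTamagawa`), `log p_v ≤ log N_E`. CONDITIONAL on Conj. 1.14.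
[cite: PastenShimura2024, Conjecture 1.14 and the remark following Theorem 1.15] -/
theorem tower_le_of_smallTamagawa (hT : Literature.NumberTheory.EllipticCurves.SmallTamagawaConjecture)
    {ε : ℝ} (hε : 0 < ε) :
    ∃ K C : ℝ, 0 ≤ K ∧ 0 ≤ C ∧ ∀ (E : WeierstrassCurve ℚ) [E.IsElliptic] (v : HeightOneSpectrum ℤ),
      (E.ordMinimalDiscriminant v : ℝ) * Real.log (natGenerator v : ℝ) ≤
        (K * (E.conductorNorm ℤ : ℝ) ^ (17 * ε) + 23) * Real.log (E.conductorNorm ℤ : ℝ) + C := by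
  obtain ⟨K, hK0, hK⟩ := jPole_le_of_smallTamagawa hT hε
  obtain ⟨C₂, hC₂⟩ := stub_potentiallyGoodTowerOdd
  obtain ⟨B, hB⟩ := stub_potentiallyGoodOrdTwo
  have hlog2 : (0 : ℝ) ≤ Real.log 2 := Real.log_nonneg one_le_two
  refine ⟨K, max C₂ 0 + (B : ℝ) * Real.log 2, hK0, by positivity, fun E _ v => ?_⟩
  have hN : 0 < E.conductorNorm ℤ := WeierstrassCurve.conductorNorm_pos_holds E
  have hN1 : (1 : ℝ) ≤ (E.conductorNorm ℤ : ℝ) := by exact_mod_cast hN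
  have hlogN : 0 ≤ Real.log (E.conductorNorm ℤ : ℝ) := Real.log_nonneg hN1
  have hNε : 0 ≤ (E.conductorNorm ℤ : ℝ) ^ (17 * ε) := Real.rpow_nonneg (by positivity) _
  have hmain : 0 ≤ (K * (E.conductorNorm ℤ : ℝ) ^ (17 * ε) + 23) * Real.log (E.conductorNorm ℤ : ℝ) := by
    positivity
  have hC₂le : C₂ ≤ max C₂ 0 := le_max_left _ _
  have hC0 : 0 ≤ max C₂ 0 := le_max_right _ _
  by_cases hj : 1 < v.valuation ℚ E.j
  · -- a `j`-pole place
    set v' : HeightOneSpectrum (𝓞 ℚ) := (primesEquiv (R := 𝓞 ℚ)).symm (primesEquiv v) with hv'def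
    have hvv' : natGenerator v = natGenerator v' :=
      (congrArg Subtype.val ((primesEquiv (R := 𝓞 ℚ)).apply_symm_apply (primesEquiv v))).symm
    have hj' : 1 < v'.valuation ℚ E.j := (one_lt_valuation_iff_of_natGenerator_eq v v' hvv' E.j).mp hj
    obtain ⟨ν, -, hν⟩ := WeierstrassCurve.exists_valuation_j_eq_exp v' E hj'
    have hn : E.ordMinimalDiscriminant v ≤ ν + 18 := ordMinimalDiscriminant_le_jPole_add E v v' hvv' hj' hν
    have hνK : (ν : ℝ) ≤ K * (E.conductorNorm ℤ : ℝ) ^ (17 * ε) := hK E v' hj' ν hν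
    -- `p_v ≤ N_E`
    have hpp : (natGenerator v).Prime := prime_natGenerator v
    have hf : E.conductorExponent v ≠ 0 := conductorExponent_ne_zero_of_one_lt_valuation_j v E hj
    have hpN : natGenerator v ≤ E.conductorNorm ℤ := by
      refine Nat.le_of_dvd hN (Nat.dvd_of_factorization_pos ?_)
      rw [WeierstrassCurve.factorization_conductorNorm_holds E v]
      exact hf
    have hp0 : (0 : ℝ) < (natGenerator v : ℝ) := by exact_mod_cast hpp.pos
    have hlogp : 0 ≤ Real.log (natGenerator v : ℝ) := Real.log_nonneg (by exact_mod_cast hpp.one_lt.le)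
    have hlogpN : Real.log (natGenerator v : ℝ) ≤ Real.log (E.conductorNorm ℤ : ℝ) :=
      Real.log_le_log hp0 (by exact_mod_cast hpN)
    have hnR : (E.ordMinimalDiscriminant v : ℝ) ≤ K * (E.conductorNorm ℤ : ℝ) ^ (17 * ε) + 18 := by
      have : (E.ordMinimalDiscriminant v : ℝ) ≤ (ν : ℝ) + 18 := by exact_mod_cast hn
      linarith
    calc (E.ordMinimalDiscriminant v : ℝ) * Real.log (natGenerator v : ℝ)
        ≤ (K * (E.conductorNorm ℤ : ℝ) ^ (17 * ε) + 18) * Real.log (E.conductorNorm ℤ : ℝ) := by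
          apply mul_le_mul hnR hlogpN hlogp
          positivity
      _ ≤ (K * (E.conductorNorm ℤ : ℝ) ^ (17 * ε) + 23) * Real.log (E.conductorNorm ℤ : ℝ) +
            (max C₂ 0 + (B : ℝ) * Real.log 2) := by
          nlinarith [hlogN, hC0, hlog2, hNε, hK0]
  · -- a potentially good (or good) place
    rw [not_lt] at hj
    have hBlog : 0 ≤ (B : ℝ) * Real.log 2 := by positivity
    have hKlog : 0 ≤ K * (E.conductorNorm ℤ : ℝ) ^ (17 * ε) * Real.log (E.conductorNorm ℤ : ℝ) := by
      positivity
    by_cases hp : natGenerator v = 2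
    · have hb : (E.ordMinimalDiscriminant v : ℝ) ≤ B := by exact_mod_cast hB E v hp hj
      rw [hp, Nat.cast_ofNat]
      have hb' : (E.ordMinimalDiscriminant v : ℝ) * Real.log 2 ≤ (B : ℝ) * Real.log 2 :=
        mul_le_mul_of_nonneg_right hb hlog2
      linarith [hb', hmain, hC0]
    · have h := hC₂ E v hp hj
      linarith [h, hlogN, hC₂le, hBlog, hKlog]

/-! ### Conj. 1.14 ⟹ sub-exponential Szpiro -/

/-- **Pasten's Conjecture 1.14 implies sub-exponential Szpiro** (`SmallTamagawaConjecture →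
SubexponentialSzpiro`): for every `ε > 0` there is `C` with `log |Δ_min(E)| ≤ C · N_E^ε` for
every elliptic `E/ℚ`, assuming `Tam(E) < K_δ N_E^δ` for all `E/ℚ` and all `δ > 0`. Sum the
per-place bound of `tower_le_of_smallTamagawa` (at `δ = ε/51`) over the `≤ log N_E/log 2` bad
primes and use `log N ≤ (3/ε) N^{ε/3}`, `(log N)² ≤ (6/ε)² N^{ε/3}`. The implication stated without
proof by Pasten (JNT 254 (2024), after Thm 1.15); CONDITIONAL result — Conj. 1.14 is open.
[cite: PastenShimura2024, Conjecture 1.14 and the remark following Theorem 1.15] -/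
theorem subexponentialSzpiro_of_smallTamagawa
    (hT : Literature.NumberTheory.EllipticCurves.SmallTamagawaConjecture) :
    Summit.ABC.Harvest.SubexponentialSzpiro := by
  intro ε hε
  have hε51 : 0 < ε / 51 := by positivity
  obtain ⟨K, C, hK0, hC0, hKC⟩ := tower_le_of_smallTamagawa hT hε51
  have hlog2 : (0 : ℝ) < Real.log 2 := Real.log_pos one_lt_two
  refine ⟨((K + 23) * (6 / ε) ^ 2 + C * (3 / ε)) / Real.log 2, fun W _ => ?_⟩
  have hN : 0 < W.conductorNorm ℤ := WeierstrassCurve.conductorNorm_pos_holds W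
  have hN1 : (1 : ℝ) ≤ (W.conductorNorm ℤ : ℝ) := by exact_mod_cast hN
  have hN0 : (0 : ℝ) ≤ (W.conductorNorm ℤ : ℝ) := by linarith
  set N : ℝ := (W.conductorNorm ℤ : ℝ) with hNdef
  have hlogN : 0 ≤ Real.log N := Real.log_nonneg hN1
  have h17 : 17 * (ε / 51) = ε / 3 := by ring
  -- the tower bound, uniform in `v`
  have hB0 : 0 ≤ (K * N ^ (ε / 3) + 23) * Real.log N + C := by positivity
  have hcore := log_minimalDiscriminantNorm_le_mul_of_towers W hB0 (fun v => by
    have h := hKC W v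
    rw [h17] at h
    exact h)
  -- logs against powers
  have hδ : 0 < ε / 3 := by positivity
  have hl1 : Real.log N ≤ (3 / ε) * N ^ (ε / 3) := by
    calc Real.log N ≤ N ^ (ε / 3) / (ε / 3) := Real.log_le_rpow_div hN0 hδ
      _ = (3 / ε) * N ^ (ε / 3) := by ring
  have hl2 : Real.log N ^ 2 ≤ (6 / ε) ^ 2 * N ^ (ε / 3) := by
    have hδ' : 0 < ε / 6 := by positivity
    have h' : Real.log N ≤ (6 / ε) * N ^ (ε / 6) := by
      calc Real.log N ≤ N ^ (ε / 6) / (ε / 6) := Real.log_le_rpow_div hN0 hδ'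
        _ = (6 / ε) * N ^ (ε / 6) := by ring
    calc Real.log N ^ 2 ≤ ((6 / ε) * N ^ (ε / 6)) ^ 2 := pow_le_pow_left₀ hlogN h' 2
      _ = (6 / ε) ^ 2 * (N ^ (ε / 6)) ^ 2 := by ring
      _ = (6 / ε) ^ 2 * N ^ (ε / 3) := by
          congr 1
          rw [← Real.rpow_two, ← Real.rpow_mul hN0]
          ring_nf
  -- `N^{ε/3} · N^{ε/3} ≤ N^ε`, `N^{ε/3} ≤ N^ε`
  have hpow1 : N ^ (ε / 3) ≤ N ^ ε := Real.rpow_le_rpow_of_exponent_le hN1 (by linarith)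
  have hpow2 : N ^ (ε / 3) * N ^ (ε / 3) ≤ N ^ ε := by
    rw [← Real.rpow_add (by linarith)]
    exact Real.rpow_le_rpow_of_exponent_le hN1 (by linarith)
  have hNε3 : 0 ≤ N ^ (ε / 3) := Real.rpow_nonneg hN0 _
  have hNε : 0 ≤ N ^ ε := Real.rpow_nonneg hN0 _
  -- assemble
  have hstep : Real.log N / Real.log 2 * ((K * N ^ (ε / 3) + 23) * Real.log N + C) ≤
      ((K + 23) * (6 / ε) ^ 2 + C * (3 / ε)) / Real.log 2 * N ^ ε := by
    rw [div_mul_eq_mul_div, div_mul_eq_mul_div, div_le_div_iff_of_pos_right hlog2]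
    have e1 : Real.log N * ((K * N ^ (ε / 3) + 23) * Real.log N + C) =
        K * (N ^ (ε / 3) * Real.log N ^ 2) + 23 * Real.log N ^ 2 + C * Real.log N := by ring
    rw [e1]
    have t1 : K * (N ^ (ε / 3) * Real.log N ^ 2) ≤ K * ((6 / ε) ^ 2 * N ^ ε) := by
      apply mul_le_mul_of_nonneg_left _ hK0
      calc N ^ (ε / 3) * Real.log N ^ 2 ≤ N ^ (ε / 3) * ((6 / ε) ^ 2 * N ^ (ε / 3)) :=
            mul_le_mul_of_nonneg_left hl2 hNε3
        _ = (6 / ε) ^ 2 * (N ^ (ε / 3) * N ^ (ε / 3)) := by ring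
        _ ≤ (6 / ε) ^ 2 * N ^ ε := mul_le_mul_of_nonneg_left hpow2 (by positivity)
    have t2 : 23 * Real.log N ^ 2 ≤ 23 * ((6 / ε) ^ 2 * N ^ ε) := by
      apply mul_le_mul_of_nonneg_left _ (by norm_num)
      exact hl2.trans (mul_le_mul_of_nonneg_left hpow1 (by positivity))
    have t3 : C * Real.log N ≤ C * ((3 / ε) * N ^ ε) := by
      apply mul_le_mul_of_nonneg_left _ hC0
      exact hl1.trans (mul_le_mul_of_nonneg_left hpow1 (by positivity))
    calc K * (N ^ (ε / 3) * Real.log N ^ 2) + 23 * Real.log N ^ 2 + C * Real.log N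
        ≤ K * ((6 / ε) ^ 2 * N ^ ε) + 23 * ((6 / ε) ^ 2 * N ^ ε) + C * ((3 / ε) * N ^ ε) := by
          linarith
      _ = ((K + 23) * (6 / ε) ^ 2 + C * (3 / ε)) * N ^ ε := by ring
  exact hcore.trans hstep

end TamagawaTwistPayoffLine

/-- **Closes stmt-ABC-24114** (crux `TamagawaTwistPayoff` of route `TamagawaTwistDictionary`):
`SmallTamagawaConjecture → Summit.ABC.Harvest.SubexponentialSzpiro` — Pasten's Conjecture 1.14
(«fudge factors are small») implies sub-exponential Szpiro, by the twist dictionary (Tate's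
`c_p = ord_p Δ_min` at split multiplicative primes, one small quadratic twist per `j`-pole place,
Kodaira–Néron / Tate's algorithm at potentially good places). A CONDITIONAL DICTIONARY: the
hypothesis is OPEN; NOT abc, NOT A-PS, does not prove A1′; moves no rung.
[cite: PastenShimura2024, Conjecture 1.14 and the remark following Theorem 1.15] -/
theorem tamagawaTwistPayoff_proof :
    Summit.ABC.ABC.Theses.TamagawaTwistDictionary.TamagawaTwistPayoff := by
  unfold Summit.ABC.ABC.Theses.TamagawaTwistDictionary.TamagawaTwistPayoff
  exact TamagawaTwistPayoffLine.subexponentialSzpiro_of_smallTamagawa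

end Summit.ABC.ABC.Theorems

end
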